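import Literature.AlgebraicGeometry.ModuliOfAbelianVarieties.SiegelHeckeQuotientTypeFrame
import Literature.AlgebraicGeometry.ModuliOfAbelianVarieties.SiegelHeckeQuotientLevelReading
import Literature.AlgebraicGeometry.ModuliOfAbelianVarieties.SiegelAdelicMarkingIsogenyQuotient
import Literature.AlgebraicGeometry.ModuliOfAbelianVarieties.SiegelAdelicMarkingRebaseToUnitBasis
import Literature.AlgebraicGeometry.ModuliOfAbelianVarieties.SiegelHeckeLink
import HarnessLib

/-!
# The Hecke ISOGENY QUOTIENT of an admissible triple is admissible at the moved period point `(θZ, r)`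
# ([Milne 2005] §5 Def. 5.14 (Hecke operators `T(g)`), §6 Thm. 6.11; [Deligne 1971] 4.11–4.12)

Topic `AlgebraicGeometry/ModuliOfAbelianVarieties`; namespace `Literature.AlgebraicGeometry.ModuliOfAbelianVarieties`.
KERNEL ONLY: theorems; no definition, no named fact, no instance, no `sorry`.

Cell hodgecm-mathlib, Hecke-link line, socket (B) = «isogeny-quotient map», pointwise clause (β) of the infinitesimal
transfer (T2): the GLUE of Route F, with every sub-brick ★ — (β1) ★ `SiegelAdelicMarking.exists_quotientMarking`
(marking of the quotient) re-based to unit basis matrix (★ `exists_rebase_γ_eq_one`), the source frame ★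
`exists_ahData_intGram_eq_typeForm_of_symplecticLift` inside (β3F) ★ `quotient_typeFrame` (AH transport + moved frame),
the level readings ★ `quotient_levelReading`, closed by ★ `isAdmissibleAt_of_levelReading_of_intGram_eq_typeForm`.

* `isAdmissibleAt_heckeQuotient` — for a source triple `P′` over `Spec ℂ` (level `N′ = N·d`, type `δ`) admissible at
  `(Z, r′)`, a target triple `Q` (level `N`, type `δ`) and a dominant homomorphism `ψ` of the identity fibres with:
  (K) kernel on ℂ-points = the marking-image of `γ⁻¹Λ_r` (through any marking by `[J(Z), r′]`), (S) onto on ℂ-points,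
  (L) `Q.σᵢ(𝟙) = ψ(P′.σᵢ(𝟙)^d)`, (W‴) for every pair of `Λ(𝒪(·))`-witnesses `Θ′` of `λ′` and `Θ` of `λ_Q`, the divisor
  `ψ^*Θ − ν•Θ′` is translation-invariant up to linear equivalence (`φ_{ψ^*Θ} = φ_{νΘ′}`), and the link's lattice clauses
  ★ `QuotientAdapted δ δ N N′ r r′ γ` with the SAME multiplier `ν` (`ᵗγ E_δ γ = ν E_δ`), `r ∈ K_δ(1)`,
  `J(Z′) = γ_ℝ J(Z) γ_ℝ⁻¹`: **`Q` is admissible at `(Z′, r)`** (★ `IsAdmissibleAt`).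

What remains OUTSIDE this file for socket (B): the algebraic quotient TRIPLE over the thick piece (H1/H2/H3: ★
`AbelianSchemeConstSubgroupQuotient`, the quotient dual pair, ★ `LevelStructure.exists_comp_changeLevel_of_coprime`) and
the bridge N4 «`ψ̂ ∘ λ_Q ∘ ψ = ν•λ′` ⇒ (W‴)» in the `IsLambdaOfAt` currency.

## References
* [Milne2005ShimuraVarieties] §5 p. 58 (Def. 5.14), §6 Thm. 6.11 pp. 74–75.
* [Deligne1971TravauxShimura] 4.11–4.12 pp. 148–149.
* [MumfordAV1970] §8 (the class of `t_x^*D − D`); [Lange2023AbelianVarietiesComplex] §1.3.3 Lemma 1.3.6 (p. 32).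
HC_CM is proved only modulo the 7 printed citations until rung 0 closes; this file discharges none of them.
-/

set_option autoImplicit false

noncomputable section

open CategoryTheory AlgebraicGeometry Matrix
open Literature.AlgebraicGeometry.Motives (AbelianVariety AlgPoints CartierDivisor specOver ComplexPoints)
open Literature.AlgebraicGeometry.AbelianSchemes (AbelianSchemeOver PolarizedAbelianSchemeWithLevel)
open Literature.Geometry.Kaehler (ComplexTorus)
open Literature.Geometry.Kaehler.ComplexTorus (AHData proj intGram picClass)
open Literature.NumberTheory.Transcendental (IsAnalytification)
open Literature.AlgebraicGeometry.HodgeTheory (cartierDivisorLineBundle)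
open Literature.NumberTheory.Adeles
open Literature.NumberTheory.Automorphic (siegelUpperHalfSpace)

namespace Literature.AlgebraicGeometry.ModuliOfAbelianVarieties

open SiegelModuli
open scoped MonObj

/-- **THE HECKE ISOGENY QUOTIENT OF AN ADMISSIBLE TRIPLE IS ADMISSIBLE AT `(θZ, r)`** (module docstring).  Proof: unpack the
datum `(m₀, Θ′, Λ′)` of `P′` at `(Z, r′)`; `r′ = r·k ∈ K_δ(1)` by (QA5); re-base `m₀` to `m` with `m.γ = 1` (same `u`);
(β1) ★ `exists_quotientMarking` marks the quotient by `[J(Z′), r]`, re-based to `m_B.γ = 1`; pick an ample `Θ` with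
`λ̄_Q = Λ(𝒪(Θ))` (★ `Polarization.exists_ample`); (β3F) ★ `quotient_typeFrame` frames `Θ` in `m_B`'s chart under (W‴) and
(QA3); ★ `quotient_levelReading` reads the level sections through `r` under (L), (QA4), (QA5); conclude by ★
`isAdmissibleAt_of_levelReading_of_intGram_eq_typeForm` on `m_B`'s own uniformisation (★ `r_eq_toFun_proj_of_γ_eq_one`).
[cite: Milne2005ShimuraVarieties, §5 p. 58 (Def. 5.14) and §6 Thm. 6.11 p. 74 and p. 75]
[cite: Deligne1971TravauxShimura, 4.11–4.12 pp. 148–149] -/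
theorem isAdmissibleAt_heckeQuotient {g N N' d : ℕ} {δ : Fin g → ℕ} (hδ : IsPolarizationType δ) (hg : 0 < g)
    (hN : 1 < N) (hd : N' = N * d) (hd0 : d ≠ 0)
    (Z : Matrix (Fin g) (Fin g) ℂ) (hZ : Z ∈ siegelUpperHalfSpace g)
    (Z' : Matrix (Fin g) (Fin g) ℂ) (hZ' : Z' ∈ siegelUpperHalfSpace g)
    (r r' : gspFinAdelic δ) (hr : r ∈ principalLevelSubgroup δ 1) (γq : GL (Fin g ⊕ Fin g) ℚ) (ν : ℕ)
    (hJ : jOfSiegel δ Z' = conjJ (Matrix.GeneralLinearGroup.map (algebraMap ℚ ℝ) γq) (jOfSiegel δ Z))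
    (hQA : QuotientAdapted δ δ N N' r r' γq)
    (hQA3 : (γq : Matrix (Fin g ⊕ Fin g) (Fin g ⊕ Fin g) ℚ)ᵀ * typeFormOver δ ℚ *
      (γq : Matrix (Fin g ⊕ Fin g) (Fin g ⊕ Fin g) ℚ) = (ν : ℚ) • typeFormOver δ ℚ)
    (P' : PolarizedAbelianSchemeWithLevel g N' δ (specOver ℚ ℂ).left)
    (Q : PolarizedAbelianSchemeWithLevel g N δ (specOver ℚ ℂ).left)
    (ψ : (P'.A.fibre (𝟙 (Spec (CommRingCat.of ℂ)))).toAbelianVariety ⟶ (Q.A.fibre (𝟙 (Spec (CommRingCat.of ℂ)))).toAbelianVariety)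
    [IsDominant ψ.hom.hom.hom.left]
    (hdim : (Q.A.fibre (𝟙 (Spec (CommRingCat.of ℂ)))).toAbelianVariety.dim = g)
    (hker : ∀ (m : SiegelAdelicMarking ⟨jOfSiegel δ Z, SiegelComplexRecordSystem.jOfSiegel_mem_C0pm hδ.1 hZ⟩ r'
        (P'.A.fibre (𝟙 (Spec (CommRingCat.of ℂ)))).toAbelianVariety) (v : Fin g ⊕ Fin g → ℚ),
      AlgPoints.map ψ.hom.hom.hom (m.r v) = 1 ↔
        (γq : Matrix (Fin g ⊕ Fin g) (Fin g ⊕ Fin g) ℚ) *ᵥ v ∈ latticeOfGL (r : GL (Fin g ⊕ Fin g) finAdeleQ))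
    (hsurj : Function.Surjective (AlgPoints.map (L := ℂ) ψ.hom.hom.hom :
      (P'.A.fibre (𝟙 (Spec (CommRingCat.of ℂ)))).toAbelianVariety.Points ℂ →
        (Q.A.fibre (𝟙 (Spec (CommRingCat.of ℂ)))).toAbelianVariety.Points ℂ))
    (hlev : ∀ i : Fin g ⊕ Fin g,
      Q.A.restrictPt (𝟙 (Spec (CommRingCat.of ℂ))) (Q.level.σ i) =
        AlgPoints.map ψ.hom.hom.hom (P'.A.restrictPt (𝟙 (Spec (CommRingCat.of ℂ))) (P'.level.σ i ^ d)))
    (hW : ∀ (Θ' : CartierDivisor (P'.A.fibre (𝟙 (Spec (CommRingCat.of ℂ)))).toAbelianVariety.X.left)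
      (Θ : CartierDivisor (Q.A.fibre (𝟙 (Spec (CommRingCat.of ℂ)))).toAbelianVariety.X.left),
      P'.A.IsLambdaOfAt (𝟙 (Spec (CommRingCat.of ℂ))) P'.D P'.pol.lam Θ' →
      Q.A.IsLambdaOfAt (𝟙 (Spec (CommRingCat.of ℂ))) Q.D Q.pol.lam Θ →
      ∀ x : (P'.A.fibre (𝟙 (Spec (CommRingCat.of ℂ)))).toAbelianVariety.Points ℂ,
        (((Θ.pullback ψ.hom.hom.hom.left + -(ν • Θ')).pullback
          ((P'.A.fibre (𝟙 (Spec (CommRingCat.of ℂ)))).toAbelianVariety.translation x).left).LinEquiv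
          (Θ.pullback ψ.hom.hom.hom.left + -(ν • Θ'))))
    (hadm : IsAdmissibleAt hδ r' Z hZ P') : IsAdmissibleAt hδ r Z' hZ' Q := by
  obtain ⟨hNd, ⟨k, hk, hrk⟩, hQA1, hQA2, hQA4, hQA3'⟩ := hQA
  -- `r′ = r k ∈ K_δ(1)`
  have hr'eq : r' = r * k := Subtype.ext (by rw [Subgroup.coe_mul]; exact hrk)
  have hr' : r' ∈ principalLevelSubgroup δ 1 := hr'eq ▸ mul_mem hr (principalLevelSubgroup_anti δ (one_dvd N) hk)
  have hN'0 : N' ≠ 0 := by rw [hd]; exact Nat.mul_ne_zero (by omega) hd0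
  -- unpack the admissibility datum of the source and re-base its marking to unit basis matrix
  obtain ⟨m₀, Θ', Λ', hΘ', hlam', hΛ'₀⟩ := hadm
  obtain ⟨m, hmγ, -, hmr⟩ := SiegelAdelicMarking.exists_rebase_γ_eq_one hr' m₀
  have hΛ' : ∀ ⦃M : ℕ⦄, N' ∣ M → M ≠ 0 → ∀ (x : Fin g ⊕ Fin g → ZMod M) (v : Fin g ⊕ Fin g → ℚ),
      AdelicCongr ((r'⁻¹ : gspFinAdelic δ) : GL (Fin g ⊕ Fin g) finAdeleQ) 1 v (fun i => ((x i).val : ℚ) / M) →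
        ((Λ'.lift M (Multiplicative.ofAdd x)) :
          (P'.A.fibre (𝟙 (Spec (CommRingCat.of ℂ)))).toAbelianVariety.Points ℂ) = m.r v := by
    intro M hM hM0 x v hv
    rw [hmr]; exact hΛ'₀ hM hM0 x v hv
  -- (β1) ★: the quotient is marked by `[J(Z′), r]`; re-base to `m_B.γ = 1` (same `u_B`)
  obtain ⟨mB₀, hmB₀⟩ := SiegelAdelicMarking.exists_quotientMarking hδ Z hZ Z' hZ' r r' γq hJ hQA1 hQA3' _ _ m ψ hdim
    (hker m) hsurj
  obtain ⟨mB, hmBγ, -, hmBr⟩ := SiegelAdelicMarking.exists_rebase_γ_eq_one hr mB₀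
  have hmB : ∀ v : Fin g ⊕ Fin g → ℚ, mB.r v = AlgPoints.map ψ.hom.hom.hom
      (m.r ((((γq⁻¹ : GL (Fin g ⊕ Fin g) ℚ) : Matrix (Fin g ⊕ Fin g) (Fin g ⊕ Fin g) ℚ)) *ᵥ v)) := by
    intro v; rw [hmBr, hmB₀]
  -- an ample `IsLambdaOfAt` witness of the target polarisation and its type frame (β3F) ★
  obtain ⟨Θ, hΘ, hlam⟩ := Q.pol.exists_ample ℂ (𝟙 (Spec (CommRingCat.of ℂ)))
  obtain ⟨p, hp, hT⟩ := quotient_typeFrame hδ hg hN'0 hZ hZ' hr' γq ν hQA3 P' _ ψ m hmγ mB hmBγ hmB Θ' hΘ' hlam' Λ'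
    hΛ' Θ (hW Θ' Θ hlam' hlam)
  -- the level readings ★
  have hlevel := quotient_levelReading hδ hN hd hd0 Z hZ Z' hZ' r r' γq hQA4 ⟨k, hk, hr'eq⟩ P'.level _ ψ m mB hmB Θ' Λ'
    hΛ' (fun i => Q.A.restrictPt (𝟙 (Spec (CommRingCat.of ℂ))) (Q.level.σ i)) hlev
  -- conclude on `m_B`'s own uniformisation
  exact isAdmissibleAt_of_levelReading_of_intGram_eq_typeForm hδ hg Q Θ hΘ hlam Z' hZ' hr mB mB.isAnalytification
    mB.toFun_add p hp hT (mB.r_eq_toFun_proj_of_γ_eq_one hmBγ) hlevel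

end Literature.AlgebraicGeometry.ModuliOfAbelianVarieties

end
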